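import Summits.CriticalPhenomena.PercolationContinuityZ3.Theorems.PercNearOneGluingNoHeavyLowerTailSahiTangentCylinderFourBridge
import Summits.CriticalPhenomena.PercolationContinuityZ3.Theorems.PercNearOneGluingNoHeavyLowerTailSahiTangentDisjointSlot
import Literature.Combinatorics.Sahi2008.Symmetry

/-!
# `NoHeavyLowerTail` (crux stmt-CriticalPhenomena-4575), Sahi programme: **VERTEX FAMILIES** — cylinder slots, some multiplied by a common coin —
# the objects of the all-orders contraction theorem for cylinders (part 1: definitions, the slot calculus and the recursion)

Support file (Sahi cell, seat `prim-sahi-p1`, generation 49; `--supports stmt-CriticalPhenomena-4575`).  Standard axioms, no `sorry`; DEFINITIONS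
`vtxSlot` (a vertex slot: the cylinder indicator `1_{C(σ)}` on both layers of `Bool × Set ι`, or only on the top layer) and `vtxD` (the contraction
defect `E_n^{B_s⊗μ}(F) − s·E_n^{μ}(1_{C(σ)})` of a vertex family).  Part 2 (`…SahiTangentVertexContraction`) proves `vtxD ≥ 0` at EVERY order.

THE SETTING (memo FROM-prim-sahi-p1-gen49-PRINCIPAL-BOTTOM-TANGENT §A6).  `μ = bernoulliWeight q` on the cube `Set ι`; the two-layer weight `B_s ⊗ μ` on
`Bool × Set ι`; a VERTEX FAMILY is given by `b : Fin n → Bool` and `σ : Fin n → Finset ι`: slot `l` is `F_l(ε,ω) = 1_{σ_l ⊆ ω}` if `b l = false` ("plain") and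
`F_l(ε,ω) = [ε]·1_{σ_l ⊆ ω}` if `b l = true` ("top-only").  These are exactly the vertices of the multilinear interpolation of gen 49's order-4 files, at every
order; `vtxD q s b σ ≥ 0` for all of them is equivalent to the contraction inequality `s·E_n^{μ}(tops) ≤ E_n^{B_s⊗μ}(F)` for all CYLINDER PAIRS at order `n`
(erasure + interpolation), and by itself says `E_n(C(σ₁∪e),…,C(σ_m∪e),C(σ_{m+1}),…,C(σ_n)) ≥ p_e·E_n(C(σ₁),…,C(σ_n))`.
THIS FILE: the slot calculus (`vtxSlot_mul_true`: the product of any vertex slot with a top-only one is top-only with the union cylinder), the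
expectations (`ex_vtxSlot_true`), invariance under permutations (`vtxD_comp_perm`), the plain case (`vtxD_of_plain`: `= (1−s)·E_n(cylinders) ≥ 0` by
Sahi's theorem for cylinders) and THE RECURSION at a top-only slot `0` (`vtxD_succ_succ`):
`vtxD(b,σ) = Σ_i vtxD(b⁺_i, σ⁺_i) − s·M(σ₀)·vtxD(tail) + s(1−s)·M(σ₀)·E_{n+1}(tail cylinders)`, where `(b⁺_i, σ⁺_i)` merges slots `0` and `i+1` into the
top-only slot `σ₀ ∪ σ_{i+1}` — the Lieb–Sahi recursion (the tree's definition of `sahiE`) read on vertex families. [this work]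
-/

namespace Summit.CriticalPhenomena.PercolationContinuityZ3.Theorems.SahiTangentCyl

open Finset Function Literature.Combinatorics.Sahi2008
open Literature.Probability.Percolation.DecisionTree (ind ind_of_mem ind_of_not_mem ind_nonneg)
open scoped BigOperators

noncomputable section

variable {ι : Type*} [DecidableEq ι]

/-! ### Vertex slots -/

/-- A VERTEX SLOT on `Bool × Set ι`: the cylinder indicator `1_{σ ⊆ ω}`, kept on both layers (`c = false`, "plain") or only on the top layer
`ε = true` (`c = true`, "top-only"). [this work] -/
def vtxSlot (c : Bool) (σ : Finset ι) : Bool × Set ι → ℝ :=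
  fun z => if c = true ∧ z.1 = false then 0 else ind {ω : Set ι | (σ : Set ι) ⊆ ω} z.2

omit [DecidableEq ι] in
/-- A plain slot is the cylinder indicator of the second coordinate. [this work] -/
theorem vtxSlot_false (σ : Finset ι) : vtxSlot false σ = fun z => ind {ω : Set ι | (σ : Set ι) ⊆ ω} z.2 := by
  funext z; simp [vtxSlot]

omit [DecidableEq ι] in
/-- A top-only slot is `ε ? 1_{C(σ)} : 0`. [this work] -/
theorem vtxSlot_true (σ : Finset ι) : vtxSlot true σ = fun z => if z.1 then ind {ω : Set ι | (σ : Set ι) ⊆ ω} z.2 else 0 := by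
  funext z; rcases z with ⟨c, ω⟩; cases c <;> simp [vtxSlot]

omit [DecidableEq ι] in
/-- On the top layer every vertex slot is its cylinder indicator. [this work] -/
theorem vtxSlot_top (c : Bool) (σ : Finset ι) (ω : Set ι) : vtxSlot c σ (true, ω) = ind {ω : Set ι | (σ : Set ι) ⊆ ω} ω := by
  cases c <;> simp [vtxSlot]

omit [DecidableEq ι] in
/-- Vertex slots are nonnegative. [this work] -/
theorem vtxSlot_nonneg (c : Bool) (σ : Finset ι) (z : Bool × Set ι) : 0 ≤ vtxSlot c σ z := by
  unfold vtxSlot; split_ifs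
  · exact le_rfl
  · exact ind_nonneg _ _

/-- **Slot calculus**: the product of any vertex slot with a TOP-ONLY slot is the top-only slot of the union cylinder. [this work] -/
theorem vtxSlot_mul_true (c : Bool) (τ σ : Finset ι) : vtxSlot c τ * vtxSlot true σ = vtxSlot true (σ ∪ τ) := by
  funext z
  rcases z with ⟨e, ω⟩
  simp only [Pi.mul_apply]
  by_cases hσ : (σ : Set ι) ⊆ ω <;> by_cases hτ : (τ : Set ι) ⊆ ω <;> cases c <;> cases e <;>
    simp [vtxSlot, ind_of_mem, ind_of_not_mem, hσ, hτ, coe_union, Set.union_subset_iff]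

/-- Products of cylinder indicators (tops): `1_{C(τ)}·1_{C(σ)} = 1_{C(σ ∪ τ)}`. [this work] -/
theorem cylInd_mul (τ σ : Finset ι) :
    ((fun ω : Set ι => ind {ω : Set ι | (τ : Set ι) ⊆ ω} ω) * fun ω : Set ι => ind {ω : Set ι | (σ : Set ι) ⊆ ω} ω)
      = fun ω : Set ι => ind {ω : Set ι | ((σ ∪ τ : Finset ι) : Set ι) ⊆ ω} ω := by
  funext ω
  simp only [Pi.mul_apply]
  by_cases hσ : (σ : Set ι) ⊆ ω <;> by_cases hτ : (τ : Set ι) ⊆ ω <;>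
    simp [ind_of_mem, ind_of_not_mem, hσ, hτ, coe_union, Set.union_subset_iff]

variable [Fintype ι]

omit [DecidableEq ι] in
/-- `E_{B_s⊗μ}(top-only slot) = s·M(σ)`. [this work] -/
theorem ex_vtxSlot_true (q : ι → unitInterval) (s : ℝ) (σ : Finset ι) :
    ex (fun z : Bool × Set ι => if z.1 then s * bernoulliWeight q z.2 else (1 - s) * bernoulliWeight q z.2) (vtxSlot true σ)
      = s * cylMass (fun e => (q e : ℝ)) σ := by
  rw [vtxSlot_true, SahiTangent.ex_coin_top, ex_ind_cyl']

/-! ### The contraction defect of a vertex family -/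

/-- **The contraction defect of a vertex family** `(b, σ)` at coin bias `s`: `E_n^{B_s⊗μ}(F) − s·E_n^{μ}(1_{C(σ_0)},…,1_{C(σ_{n−1})})`,
`μ = bernoulliWeight q`. [this work] -/
def vtxD (q : ι → unitInterval) (s : ℝ) (n : ℕ) (b : Fin n → Bool) (σ : Fin n → Finset ι) : ℝ :=
  sahiE (fun z : Bool × Set ι => if z.1 then s * bernoulliWeight q z.2 else (1 - s) * bernoulliWeight q z.2) n (fun l => vtxSlot (b l) (σ l))
    - s * sahiE (bernoulliWeight q) n (fun l (ω : Set ι) => ind {ω : Set ι | (σ l : Set ι) ⊆ ω} ω)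

omit [DecidableEq ι] in
/-- Invariance under relabelling the slots. [this work] -/
theorem vtxD_comp_perm (q : ι → unitInterval) (s : ℝ) {n : ℕ} (π : Equiv.Perm (Fin n)) (b : Fin n → Bool) (σ : Fin n → Finset ι) :
    vtxD q s n (b ∘ π) (σ ∘ π) = vtxD q s n b σ := by
  unfold vtxD
  have h1 := sahiE_comp_perm (fun z : Bool × Set ι => if z.1 then s * bernoulliWeight q z.2 else (1 - s) * bernoulliWeight q z.2) n π
    (fun l => vtxSlot (b l) (σ l))
  have h2 := sahiE_comp_perm (bernoulliWeight q) n π (fun l (ω : Set ι) => ind {ω : Set ι | (σ l : Set ι) ⊆ ω} ω)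
  simp only [Function.comp] at h1 h2 ⊢
  rw [h1, h2]

omit [DecidableEq ι] in
/-- **Sahi's theorem for cylinders**: `E_n(1_{C(σ_0)},…,1_{C(σ_{n−1})}) ≥ 0` under every product weight (tree: Blinovsky/Sahi for cumulations). [this work] -/
theorem sahiE_cyl_nonneg (q : ι → unitInterval) {n : ℕ} (σ : Fin n → Finset ι) :
    0 ≤ sahiE (bernoulliWeight q) n (fun l (ω : Set ι) => ind {ω : Set ι | (σ l : Set ι) ⊆ ω} ω) := by
  have h := sahiE_bernoulliWeight_ind_nonneg_offTwo q (fun l => {ω : Set ι | (σ l : Set ι) ⊆ ω}) ∅ (by simp)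
    (fun i hi => absurd hi (by simp)) (fun l => ((σ l : Finset ι) : Set ι)) (fun l _ => rfl)
  exact h

omit [DecidableEq ι] in
/-- **The plain case**: with no top-only slot, `vtxD = (1−s)·E_n(cylinders)`. [this work] -/
theorem vtxD_of_plain (q : ι → unitInterval) (s : ℝ) {n : ℕ} {b : Fin n → Bool} (hb : ∀ l, b l = false) (σ : Fin n → Finset ι) :
    vtxD q s n b σ = (1 - s) * sahiE (bernoulliWeight q) n (fun l (ω : Set ι) => ind {ω : Set ι | (σ l : Set ι) ⊆ ω} ω) := by
  unfold vtxD
  have e : (fun l => vtxSlot (b l) (σ l)) = fun l (z : Bool × Set ι) => (fun l' (ω : Set ι) => ind {ω : Set ι | (σ l' : Set ι) ⊆ ω} ω) l z.2 := by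
    funext l z; rw [hb l, vtxSlot_false]
  rw [e, SahiTangent.sahiE_coin_snd]
  ring

omit [DecidableEq ι] in
/-- The plain case is nonnegative for `s ≤ 1`. [this work] -/
theorem vtxD_nonneg_of_plain (q : ι → unitInterval) {s : ℝ} (hs1 : s ≤ 1) {n : ℕ} {b : Fin n → Bool} (hb : ∀ l, b l = false)
    (σ : Fin n → Finset ι) : 0 ≤ vtxD q s n b σ := by
  rw [vtxD_of_plain q s hb σ]
  exact mul_nonneg (sub_nonneg.2 hs1) (sahiE_cyl_nonneg q σ)

/-! ### The recursion at a top-only slot `0` -/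

omit [Fintype ι] in
/-- Merging slot `0` (top-only) into slot `i+1`: the updated `tail` family is again a vertex family. [this work] -/
theorem update_tail_vtx {n : ℕ} (b : Fin (n + 2) → Bool) (σ : Fin (n + 2) → Finset ι) (hb0 : b 0 = true) (i : Fin (n + 1)) :
    update (Fin.tail (fun l => vtxSlot (b l) (σ l))) i (Fin.tail (fun l => vtxSlot (b l) (σ l)) i * (fun l => vtxSlot (b l) (σ l)) 0)
      = fun l => vtxSlot (update (Fin.tail b) i true l) (update (Fin.tail σ) i (σ 0 ∪ σ i.succ) l) := by
  funext l
  by_cases hl : l = i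
  · subst hl
    simp only [update_self, Fin.tail, hb0]
    exact vtxSlot_mul_true _ _ _
  · simp only [update_of_ne hl, Fin.tail]

omit [Fintype ι] in
/-- The same for the family of top cylinders. [this work] -/
theorem update_tail_cyl {n : ℕ} (σ : Fin (n + 2) → Finset ι) (i : Fin (n + 1)) :
    update (Fin.tail (fun l (ω : Set ι) => ind {ω : Set ι | (σ l : Set ι) ⊆ ω} ω)) i
        (Fin.tail (fun l (ω : Set ι) => ind {ω : Set ι | (σ l : Set ι) ⊆ ω} ω) i * (fun l (ω : Set ι) => ind {ω : Set ι | (σ l : Set ι) ⊆ ω} ω) 0)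
      = fun l (ω : Set ι) => ind {ω : Set ι | ((update (Fin.tail σ) i (σ 0 ∪ σ i.succ) l : Finset ι) : Set ι) ⊆ ω} ω := by
  funext l
  by_cases hl : l = i
  · subst hl
    simp only [update_self, Fin.tail]
    exact cylInd_mul _ _
  · simp only [update_of_ne hl, Fin.tail]

/-- **THE RECURSION.**  For a vertex family on `n+2` slots whose slot `0` is top-only:
`vtxD(b,σ) = Σ_i vtxD(b⁺_i,σ⁺_i) − s·M(σ₀)·vtxD(tail b, tail σ) + s(1−s)·M(σ₀)·E_{n+1}(tail cylinders)`,
with `b⁺_i = update (tail b) i true`, `σ⁺_i = update (tail σ) i (σ₀ ∪ σ_{i+1})`. [this work] -/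
theorem vtxD_succ_succ (q : ι → unitInterval) (s : ℝ) {n : ℕ} (b : Fin (n + 2) → Bool) (σ : Fin (n + 2) → Finset ι) (hb0 : b 0 = true) :
    vtxD q s (n + 2) b σ =
      (∑ i : Fin (n + 1), vtxD q s (n + 1) (update (Fin.tail b) i true) (update (Fin.tail σ) i (σ 0 ∪ σ i.succ)))
        - s * cylMass (fun e => (q e : ℝ)) (σ 0) * vtxD q s (n + 1) (Fin.tail b) (Fin.tail σ)
        + s * (1 - s) * cylMass (fun e => (q e : ℝ)) (σ 0)
          * sahiE (bernoulliWeight q) (n + 1) (fun l (ω : Set ι) => ind {ω : Set ι | (Fin.tail σ l : Set ι) ⊆ ω} ω) := by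
  unfold vtxD
  rw [sahiE_succ_succ, sahiE_succ_succ]
  simp only [update_tail_vtx b σ hb0, update_tail_cyl σ]
  have e0 : vtxSlot (b 0) (σ 0) = vtxSlot true (σ 0) := by rw [hb0]
  rw [e0, ex_vtxSlot_true, ex_ind_cyl']
  have et : Fin.tail (fun l => vtxSlot (b l) (σ l)) = fun l => vtxSlot (Fin.tail b l) (Fin.tail σ l) := rfl
  have et' : Fin.tail (fun l (ω : Set ι) => ind {ω : Set ι | (σ l : Set ι) ⊆ ω} ω)
      = fun l (ω : Set ι) => ind {ω : Set ι | (Fin.tail σ l : Set ι) ⊆ ω} ω := rfl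
  rw [et, et']
  simp only [Finset.sum_sub_distrib, ← Finset.mul_sum]
  ring

end

end Summit.CriticalPhenomena.PercolationContinuityZ3.Theorems.SahiTangentCyl
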